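import Summits.BirchSwinnertonDyer.BirchSwinnertonDyer.Theorems.KimAtThreeDeepLowerOffStratumLevelLoweringVatsalIhara
import Summits.BirchSwinnertonDyer.BirchSwinnertonDyer.Theorems.KimAtThreeDeepLowerOffStratumLevelLoweringVatsalStabCovered
import HarnessLib

/-!
# Route `KimAtThreeKolyvagin` (rung W2), crux `DeepLowerAtThreeOffKatoStratum` (item 19679), registered
# stub `stub_nonAdditive`, ROAD (b): the depth-`1` Tamagawa rows from VATSAL / GREENBERG–VATSAL and IHARA BY
# NAME — the semistable and covered rows with the non-degeneracy discharged by THEOREM D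

Cell `bsd-addord`, seat `bsd-addord-w2-acc2` (PROGRAMME PART 1b, ACCEL-LIST row (2)), gen 4; item
`stmt-BirchSwinnertonDyer-19679` (OWNER w2-c2 assembles; `--supports`, closes nothing). Eighth file of ROAD (b):
`…VatsalStabRows` / `…VatsalStabCovered` derived the 19679 rows (semistable / covered, `v₃(∏ c_ℓ) ≤ 1`, Tamagawa-`3`
prime `q` split multiplicative) from the named facts `vatsal1999_plusSymbol_congruence` /
`greenbergVatsal2000_plusSymbol_congruence`, a level-`N/q` newform `g` congruent to `D₀.f` at the primes, a root
`β ≡ q`, Vatsal's Condition 1 ×2 and the displayed NON-DEGENERACY «`(plusSymbol g x₀ − (β/q) plusSymbol g (qx₀))/Ω`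
a unit for some `x₀`» (Ihara read on symbols). `…VatsalIhara` (THEOREM D) proved that clause from the NAMED FACT
`ribet1984_iharaLemma`. Here the two are composed: ★ `stub_nonAdditive_semistable_of_vatsal_of_ihara`,
★ `stub_nonAdditive_covered_of_vatsal_of_ihara` — the rows from NINE named facts (`hV hGV hI` + the six / seven
of the cell's dictionary) and the DISPLAYED residual: the newform `g ∈ S₂(Γ₀(M))` (`M·q = N_E`, `q ∤ M`) with
`a_ℓ(g) ≡ a_ℓ(D₀.f)` (`ℓ ≠ q` prime), `a_q(g) ≡ q + 1`; `β` with `β² − a_q(g)β + q = 0`, `β ≡ q`; Condition 1 for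
`D₀.f` and `ι₁ g − β ι_q g`; a normalisation `Ω` of `plusSymbol g` (integral on `ℚ`, a unit at ONE cycle cusp
`γ₀∞`, `γ₀ ∈ Γ₀(M)` — in print the canonical period of `g`); ONE non-Eisenstein numeral prime `r₀ ≡ 1 (mod Mq)`,
`r₀ ∤ Mq`, `a_{r₀}(g) ≢ r₀ + 1 (mod 𝔪)` (Chebotarev for the irreducible `ρ̄`). Theorems only; nothing booked;
BSD is not proved by any of this.

## References

* V. Vatsal, Duke Math. J. 98 (1999), §1 (1.6), Thm. (1.13) [Vatsal1999]; R. Greenberg, V. Vatsal, Invent. Math.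
  142 (2000), §3 (17)–(19) [GreenbergVatsal2000]; K. A. Ribet, Proc. ICM 1983 (1984), Thm. 4.1 [Ribet1984ICM];
  K. A. Ribet, Invent. Math. 100 (1990), Thm. 1.1 [Ribet1990].
* C. Skinner (2016), Thm. C [Skinner2016PacificMC]; X. Yan, X. Zhu, Thm. 4.15 [YanZhu2024MainConjNonCM];
  B. Mazur (1978), Cor. 4.1 [Mazur1978]; C.-H. Kim (2022/2026), Conj. 1.10 [Kim2022StructureSelmer].
-/

set_option autoImplicit false
-- the Theorems namespace of a single-conjunct summit repeats the summit name by design (D-0017)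
set_option linter.dupNamespace false

noncomputable section

open scoped MatrixGroups ModularForm Classical NNReal

open CongruenceSubgroup WeierstrassCurve Literature.NumberTheory.EllipticCurves
  Literature.NumberTheory.EllipticCurves.ModularForms

namespace Summit.BirchSwinnertonDyer.BirchSwinnertonDyer.Theorems.KimAtThreeDeepLowerOffStratumLevelLoweringVatsalIharaRows

open Summit.BirchSwinnertonDyer.BirchSwinnertonDyer.Theorems.KimAtThreeDeepLowerOffStratumLevelLoweringVatsal
open Summit.BirchSwinnertonDyer.BirchSwinnertonDyer.Theorems.KimAtThreeDeepLowerOffStratumLevelLoweringVatsalStabRows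
open Summit.BirchSwinnertonDyer.BirchSwinnertonDyer.Theorems.KimAtThreeDeepLowerOffStratumLevelLoweringVatsalStabCovered
open Summit.BirchSwinnertonDyer.BirchSwinnertonDyer.Theorems.KimAtThreeDeepLowerOffStratumLevelLoweringVatsalIhara
open Literature.NumberTheory.EllipticCurves.Rank1Residual Literature.NumberTheory.EllipticCurves.Rank1Residual.Typed
  Literature.NumberTheory.EllipticCurves.Skinner2016 Literature.NumberTheory.Automorphic

/-- ★ **`stub_nonAdditive` on its SEMISTABLE rows with `v₃(∏ c_ℓ) ≤ 1` — Vatsal / Greenberg–Vatsal AND IHARA BY NAME.**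
As `…VatsalStabRows.stub_nonAdditive_semistable_of_vatsal_of_levelLoweredNewform`, with the non-degeneracy clause
replaced by `ribet1984_iharaLemma` + `Ω` a unit at one cycle cusp `γ₀∞` + one non-Eisenstein numeral `r₀`.
[cite: Vatsal1999, §1 (1.6), Thm. (1.13)] [cite: GreenbergVatsal2000, §3 (17)–(19)] [cite: Ribet1984ICM, Thm. 4.1]
[cite: Ribet1990, Thm. 1.1] [cite: Skinner2016PacificMC, Thm. C (§1)] [cite: Mazur1978, Cor. 4.1]
[cite: Kim2022StructureSelmer, Conj. 1.10 (PDF p. 8)] -/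
theorem stub_nonAdditive_semistable_of_vatsal_of_ihara
    (hV : vatsal1999_plusSymbol_congruence) (hGV : greenbergVatsal2000_plusSymbol_congruence)
    (hI : ribet1984_iharaLemma)
    (hSk : Skinner2016.thmC_padicValRat_bsd_rank_zero)
    (hmod : hasEntireLFunction_rat) (hGZK : rank_eq_analyticRank_of_analyticRank_le_one)
    (hM : mazur_not_dvd_maninConstant_of_odd)
    (hBCDT : exists_isNewformOf) (hLL' : diamond1995_refinedSerre) :
    ∀ (W₀ : WeierstrassCurve ℚ) [W₀.IsElliptic] [W₀.IsGloballyMinimal],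
      (∀ n : ℕ, W₀.HasSurjectiveModNGaloisRep (3 ^ n : ℕ)) → Finite W₀.sha →
      ∀ {M q : ℕ} [NeZero M] [NeZero q] [Fact q.Prime] [NeZero (M * q)], M * q = W₀.conductorNorm ℤ →
      ∀ (D₀ : ModularParametrizationData W₀ (M * q)),
        (∀ z ∈ D₀.L.lattice, ∃ w ∈ periodLattice D₀.f, z = D₀.c * w) →
        (∀ (W₂ : WeierstrassCurve ℚ) [W₂.IsElliptic] (D₂ : ModularParametrizationData W₂ (M * q)),
          D₂.f = D₀.f → D₀.modularDegree ≤ D₂.modularDegree) →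
        (∀ r : ℚ, ratPlusSymbol D₀.f r ≠ 0 → 0 ≤ padicValRat 3 (ratPlusSymbol D₀.f r)) →
        kuriharaVanishingOrder W₀ 3 D₀.f = 0 →
        ¬ (haveI : Fact (Nat.Prime 3) := ⟨Nat.prime_three⟩; Addv W₀ 3) →
        Semistable W₀ →
        (W₀.HasGoodReductionAtPrime 3 → ¬ (3 : ℤ) ∣ W₀.frobeniusTrace 3) →
        padicValNat 3 W₀.tamagawaProduct ≤ 1 →
        W₀.HasSplitMultiplicativeReductionAtPrime q →
        ∀ (ι : PadicAlgCl 3 ≃+* ℂ) (g : CuspForm (Gamma0 M) 2), IsNewform0 g → ¬ q ∣ M →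
          (∀ ℓ : ℕ, ℓ.Prime → ℓ ≠ q → Valued.v (ι.symm (cuspCoeff D₀.f ℓ - cuspCoeff g ℓ)) < 1) →
          Valued.v (ι.symm (cuspCoeff g q - (q + 1))) < 1 →
        ∀ (β : ℂ), β ^ 2 - cuspCoeff g q * β + q = 0 → Valued.v (ι.symm (β - q)) < 1 →
          HasSimpleHeckeGenEigenspace D₀.f →
          HasSimpleHeckeGenEigenspace
            (iota M (M * q) 1 2 (mul_dvd_mul_left M (one_dvd q)) g - β • iota M (M * q) q 2 dvd_rfl g) →
        ∀ (Ω : ℂ), (∀ x : ℚ, Valued.v (ι.symm (plusSymbol g x / Ω)) ≤ 1) →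
        ∀ (γ₀ : Gamma0 M), (γ₀ : SL(2, ℤ)) 1 0 ≠ 0 →
          Valued.v (ι.symm (plusSymbol g
            ((((γ₀ : SL(2, ℤ)) 0 0 : ℤ) : ℚ) / (((γ₀ : SL(2, ℤ)) 1 0 : ℤ) : ℚ)) / Ω)) = 1 →
        ∀ {r₀ : ℕ}, r₀.Prime → ¬ r₀ ∣ M * q → r₀ ≡ 1 [MOD M * q] →
          Valued.v (ι.symm (cuspCoeff g r₀ - (r₀ + 1))) = 1 →
        ∃ d : ℕ, kuriharaPartialDeepInfty W₀ 3 D₀.f = d ∧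
          kuriharaPartial W₀ 3 D₀.f 0 ≤
            ((padicValNat 3 (Nat.card (AddCommGroup.primaryComponent W₀.sha 3)) + d : ℕ) : ℕ∞) := by
  intro W₀ _ _ htower hfin M q _ _ _ _ hN D₀ hopt hdeg hint hord hnA hsst hordinary hv hsplit ι g hg hqM hcℓ haq β hβ
    hβq hfC hgC Ω hΩint γ₀ hγ₀ hunit r₀ hr₀ hr₀S hr₀1 hE₀
  have hq : q.Prime := Fact.out
  obtain ⟨-, hc⟩ := valuation_div_sub_one_lt_one ι hq hβ haq hβq
  have hΩunit := exists_valuation_stabilisedSymbol_eq_one_of_ribet1984_iharaLemma hI hq hqM hg ι hΩint γ₀ hγ₀ hunit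
    hr₀ hr₀S hr₀1 hE₀ hc
  exact stub_nonAdditive_semistable_of_vatsal_of_levelLoweredNewform hV hGV hSk hmod hGZK hM hBCDT hLL' W₀ htower hfin
    hN D₀ hopt hdeg hint hord hnA hsst hordinary hv hsplit ι g hg hqM hcℓ haq β hβ hβq hfC hgC Ω hΩint hΩunit

/-- ★ **`stub_nonAdditive` on its COVERED rows with `v₃(∏ c_ℓ) ≤ 1` (split-multiplicative Tamagawa prime) —
Vatsal / Greenberg–Vatsal AND IHARA BY NAME.** [cite: Vatsal1999, §1 (1.6), Thm. (1.13)]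
[cite: GreenbergVatsal2000, §3 (17)–(19)] [cite: Ribet1984ICM, Thm. 4.1] [cite: YanZhu2024MainConjNonCM, Thm. 4.15 (§4.6)]
[cite: Skinner2016PacificMC, Thm. C (§1)] [cite: Mazur1978, Cor. 4.1] [cite: Kim2022StructureSelmer, Conj. 1.10 (PDF p. 8)] -/
theorem stub_nonAdditive_covered_of_vatsal_of_ihara
    (hV : vatsal1999_plusSymbol_congruence) (hGV : greenbergVatsal2000_plusSymbol_congruence)
    (hI : ribet1984_iharaLemma)
    (hYZ : YanZhu2026.thm415_padicValRat_bsd_rank_le_one)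
    (hW20 : Wuthrich2014.lemma20_surjective_threeAdic_of_semistable)
    (hSk : Skinner2016.thmC_padicValRat_bsd_rank_zero)
    (hmod : hasEntireLFunction_rat) (hGZK : rank_eq_analyticRank_of_analyticRank_le_one)
    (hM : mazur_not_dvd_maninConstant_of_odd) :
    ∀ (W₀ : WeierstrassCurve ℚ) [W₀.IsElliptic] [W₀.IsGloballyMinimal],
      (∀ n : ℕ, W₀.HasSurjectiveModNGaloisRep (3 ^ n : ℕ)) → Finite W₀.sha →
      ∀ {M q : ℕ} [NeZero M] [NeZero q] [Fact q.Prime] [NeZero (M * q)], M * q = W₀.conductorNorm ℤ →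
      ∀ (D₀ : ModularParametrizationData W₀ (M * q)),
        (∀ z ∈ D₀.L.lattice, ∃ w ∈ periodLattice D₀.f, z = D₀.c * w) →
        (∀ (W₂ : WeierstrassCurve ℚ) [W₂.IsElliptic] (D₂ : ModularParametrizationData W₂ (M * q)),
          D₂.f = D₀.f → D₀.modularDegree ≤ D₂.modularDegree) →
        (∀ r : ℚ, ratPlusSymbol D₀.f r ≠ 0 → 0 ≤ padicValRat 3 (ratPlusSymbol D₀.f r)) →
        kuriharaVanishingOrder W₀ 3 D₀.f = 0 →
        ¬ (haveI : Fact (Nat.Prime 3) := ⟨Nat.prime_three⟩; Addv W₀ 3) →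
        (W₀.HasGoodReductionAtPrime 3 → ¬ (3 : ℤ) ∣ W₀.frobeniusTrace 3) →
        (W₀.HasMultiplicativeReductionAtPrime 3 →
          (haveI : Fact (Nat.Prime 3) := ⟨Nat.prime_three⟩; Ram W₀ 3)) →
        padicValNat 3 W₀.tamagawaProduct ≤ 1 →
        W₀.HasSplitMultiplicativeReductionAtPrime q →
        ∀ (ι : PadicAlgCl 3 ≃+* ℂ) (g : CuspForm (Gamma0 M) 2), IsNewform0 g → ¬ q ∣ M →
          (∀ ℓ : ℕ, ℓ.Prime → ℓ ≠ q → Valued.v (ι.symm (cuspCoeff D₀.f ℓ - cuspCoeff g ℓ)) < 1) →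
          Valued.v (ι.symm (cuspCoeff g q - (q + 1))) < 1 →
        ∀ (β : ℂ), β ^ 2 - cuspCoeff g q * β + q = 0 → Valued.v (ι.symm (β - q)) < 1 →
          HasSimpleHeckeGenEigenspace D₀.f →
          HasSimpleHeckeGenEigenspace
            (iota M (M * q) 1 2 (mul_dvd_mul_left M (one_dvd q)) g - β • iota M (M * q) q 2 dvd_rfl g) →
        ∀ (Ω : ℂ), (∀ x : ℚ, Valued.v (ι.symm (plusSymbol g x / Ω)) ≤ 1) →
        ∀ (γ₀ : Gamma0 M), (γ₀ : SL(2, ℤ)) 1 0 ≠ 0 →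
          Valued.v (ι.symm (plusSymbol g
            ((((γ₀ : SL(2, ℤ)) 0 0 : ℤ) : ℚ) / (((γ₀ : SL(2, ℤ)) 1 0 : ℤ) : ℚ)) / Ω)) = 1 →
        ∀ {r₀ : ℕ}, r₀.Prime → ¬ r₀ ∣ M * q → r₀ ≡ 1 [MOD M * q] →
          Valued.v (ι.symm (cuspCoeff g r₀ - (r₀ + 1))) = 1 →
        ∃ d : ℕ, kuriharaPartialDeepInfty W₀ 3 D₀.f = d ∧
          kuriharaPartial W₀ 3 D₀.f 0 ≤
            ((padicValNat 3 (Nat.card (AddCommGroup.primaryComponent W₀.sha 3)) + d : ℕ) : ℕ∞) := by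
  intro W₀ _ _ htower hfin M q _ _ _ _ hN D₀ hopt hdeg hint hord hnA hordinary hram hv hsplit ι g hg hqM hcℓ haq β hβ
    hβq hfC hgC Ω hΩint γ₀ hγ₀ hunit r₀ hr₀ hr₀S hr₀1 hE₀
  have hq : q.Prime := Fact.out
  obtain ⟨-, hc⟩ := valuation_div_sub_one_lt_one ι hq hβ haq hβq
  have hΩunit := exists_valuation_stabilisedSymbol_eq_one_of_ribet1984_iharaLemma hI hq hqM hg ι hΩint γ₀ hγ₀ hunit
    hr₀ hr₀S hr₀1 hE₀ hc
  exact stub_nonAdditive_covered_of_vatsal_of_levelLoweredNewform hV hGV hYZ hW20 hSk hmod hGZK hM W₀ htower hfin hN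
    D₀ hopt hdeg hint hord hnA hordinary hram hv hsplit ι g hg hqM hcℓ haq β hβ hβq hfC hgC Ω hΩint hΩunit

end Summit.BirchSwinnertonDyer.BirchSwinnertonDyer.Theorems.KimAtThreeDeepLowerOffStratumLevelLoweringVatsalIharaRows

end
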